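import Mathlib
import Summits.Ventures.PercRepro2.V2SP
import Summits.Ventures.PercRepro2.Tail2DCount
import Summits.Ventures.PercRepro2.Tail2DThreePoint
import Summits.Ventures.PercRepro2.Tail2DP2Series
import Summits.Ventures.PercRepro2.Tail2DDisjointPaths
import Summits.Ventures.PercRepro2.Tail2DP2SeriesSP
import Summits.Ventures.PercRepro2.Tail2DAxisUnimodal
import Summits.Ventures.PercRepro2.Tail2DOffAxis31

/-!
# Off the axis, second member: `T(4,1) ≤ T(3,2)` on every series–parallel network (seat mine-b, cell pub-perc-repro2)

For every pattern `s` of the cell's grammar, uniformly two-coloured,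

  `#{r ≥ 4 ∧ b ≥ 1} ≤ #{r ≥ 3 ∧ b ≥ 2}`   (`t41_le_t32`),

the member `(a, j) = (4, 1)` of the off-axis anti-diagonal unimodality `T(a, j) ≤ T(a−1, j+1)`;
`(3, 1)` is `t31_le_t22`, the axis members are `tail_axis_unimodal`. Same proof as for `(3, 1)`: series
multiplies the tails; for a parallel composition both tails are bilinear in the capped cells of the
factors (`K = 4`, `card_par_capped`), and `T(3,2) − T(4,1)` of the composition is the non-negative
combination (an LP certificate, verified exactly on symmetric capped arrays; registry §35.13)

  `D₁(3,0)·#{r₂ = 1, b₂ ≥ 1} + D₁(4,0)·#{r₂ = 0, b₂ ≥ 1} + D₁(3,1)·N₂(1,0) + D₁(4,1)·N₂(0,0)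
   + N₁(0,0)·D₂(4,1) + N₁(0,1)·(D₂(4,0) + D₂(3,1)) + #{r₁ = 0, b₁ ≥ 2}·(D₂(3,0) + D₂(4,0)) + D₁(2,0)·D₂(3,0)
   + #{r₁ = 0, b₁ ≥ 2}·#{r₂ = 0, b₂ ≥ 3} + #{r₁ = 0, b₁ ≥ 3}·#{r₂ = 0, b₂ ≥ 2}`,

`D(a, j) = T(a−1, j+1) − T(a, j)`, with the axis theorems `D(2,0)`, `D(3,0)`, `D(4,0)`, the landed
`D(3,1)` and the induction hypothesis `D(4,1)` of the factors.
-/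

namespace Summit.Ventures.PercRepro2.Tail2D

open V2Closure

/-- a tail with thresholds `≤ K` in the capped cells -/
lemma tail_cellsK (s : V2Closure.SP) (K a j : ℕ) (ha : a ≤ K) (hj : j ≤ K) :
    (Finset.univ.filter (fun y : s.Conf => a ≤ s.rLab y ∧ j ≤ s.bLab y)).card
      = ∑ x ∈ Finset.range (K + 1), ∑ y ∈ Finset.range (K + 1), if a ≤ x ∧ j ≤ y then cellCount s K x y else 0 := by
  have e : (Finset.univ.filter (fun y : s.Conf => a ≤ s.rLab y ∧ j ≤ s.bLab y))
      = Finset.univ.filter (fun y : s.Conf => a ≤ min (s.rLab y) K ∧ j ≤ min (s.bLab y) K) := by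
    ext y; simp only [Finset.mem_filter, Finset.mem_univ, true_and]; omega
  rw [e]; exact card_cells s K (fun r b => a ≤ r ∧ j ≤ b)

/-- a tail of a parallel composition with thresholds `≤ K` in the capped cells of the factors -/
lemma tail_par_cellsK (s t : V2Closure.SP) (K a j : ℕ) (ha : a ≤ K) (hj : j ≤ K) :
    (Finset.univ.filter (fun p : (V2Closure.SP.par s t).Conf =>
        a ≤ (V2Closure.SP.par s t).rLab p ∧ j ≤ (V2Closure.SP.par s t).bLab p)).card
      = ∑ x ∈ Finset.range (K + 1), ∑ y ∈ Finset.range (K + 1), ∑ u ∈ Finset.range (K + 1), ∑ v ∈ Finset.range (K + 1),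
          if a ≤ min (x + u) K ∧ j ≤ min (y + v) K then cellCount s K x y * cellCount t K u v else 0 := by
  have e : (Finset.univ.filter (fun p : (V2Closure.SP.par s t).Conf =>
        a ≤ (V2Closure.SP.par s t).rLab p ∧ j ≤ (V2Closure.SP.par s t).bLab p))
      = Finset.univ.filter (fun p : (V2Closure.SP.par s t).Conf =>
        a ≤ min ((V2Closure.SP.par s t).rLab p) K ∧ j ≤ min ((V2Closure.SP.par s t).bLab p) K) := by
    ext p; simp only [Finset.mem_filter, Finset.mem_univ, true_and]; omega
  rw [e]; exact card_par_capped s t K (fun r b => a ≤ r ∧ j ≤ b)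

/-- a tail `#{a ≤ r}` as a two-sided tail with threshold `0` on the blue flow -/
lemma tail_b0 (s : V2Closure.SP) (a : ℕ) :
    (Finset.univ.filter (fun y : s.Conf => a ≤ s.rLab y)).card
      = (Finset.univ.filter (fun y : s.Conf => a ≤ s.rLab y ∧ 0 ≤ s.bLab y)).card := by
  congr 1; ext y; simp

/-- a tail of a parallel composition as a sum over the capped cells of the first factor of
cell × (a tail of the second factor): `T(a,j)'' = Σ_{x,y ≤ K} cell_s(x,y) · T_t(a ∸ x, j ∸ y)` -/
lemma tail_par_rows (s t : V2Closure.SP) (K a j : ℕ) (ha : a ≤ K) (hj : j ≤ K) :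
    (Finset.univ.filter (fun p : (V2Closure.SP.par s t).Conf =>
        a ≤ (V2Closure.SP.par s t).rLab p ∧ j ≤ (V2Closure.SP.par s t).bLab p)).card
      = ∑ x ∈ Finset.range (K + 1), ∑ y ∈ Finset.range (K + 1),
          cellCount s K x y * (Finset.univ.filter (fun q : t.Conf => a - x ≤ t.rLab q ∧ j - y ≤ t.bLab q)).card := by
  change (Finset.univ.filter (fun p : s.Conf × t.Conf => a ≤ s.rLab p.1 + t.rLab p.2 ∧ j ≤ s.bLab p.1 + t.bLab p.2)).card = _
  rw [Finset.card_eq_sum_card_fiberwise (f := fun p : s.Conf × t.Conf => (min (s.rLab p.1) K, min (s.bLab p.1) K))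
    (t := Finset.range (K + 1) ×ˢ Finset.range (K + 1))
    (fun p _ => by
      show (min (s.rLab p.1) K, min (s.bLab p.1) K) ∈ Finset.range (K + 1) ×ˢ Finset.range (K + 1)
      simp only [Finset.mem_product, Finset.mem_range]; omega), Finset.sum_product]
  refine Finset.sum_congr rfl (fun x hx => Finset.sum_congr rfl (fun y hy => ?_))
  have hx' : x ≤ K := by simpa only [Finset.mem_range, Nat.lt_succ_iff] using hx
  have hy' : y ≤ K := by simpa only [Finset.mem_range, Nat.lt_succ_iff] using hy
  unfold cellCount
  rw [Finset.filter_filter, Finset.card_filter, Finset.card_filter, Finset.card_filter,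
    ← sum_prod_ite s t (fun a' => min (s.rLab a') K = x ∧ min (s.bLab a') K = y) (fun q => a - x ≤ t.rLab q ∧ j - y ≤ t.bLab q)]
  refine Finset.sum_congr rfl (fun p _ => ?_)
  simp only [Prod.mk.injEq]
  split_ifs <;> omega

/-- the parallel step of `T(4,1) ≤ T(3,2)` -/
lemma t41_le_t32_par (s t : V2Closure.SP)
    (hs : (Finset.univ.filter (fun y : s.Conf => 4 ≤ s.rLab y ∧ 1 ≤ s.bLab y)).card
      ≤ (Finset.univ.filter (fun y : s.Conf => 3 ≤ s.rLab y ∧ 2 ≤ s.bLab y)).card)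
    (ht : (Finset.univ.filter (fun y : t.Conf => 4 ≤ t.rLab y ∧ 1 ≤ t.bLab y)).card
      ≤ (Finset.univ.filter (fun y : t.Conf => 3 ≤ t.rLab y ∧ 2 ≤ t.bLab y)).card) :
    (Finset.univ.filter (fun p : (V2Closure.SP.par s t).Conf =>
        4 ≤ (V2Closure.SP.par s t).rLab p ∧ 1 ≤ (V2Closure.SP.par s t).bLab p)).card
      ≤ (Finset.univ.filter (fun p : (V2Closure.SP.par s t).Conf =>
        3 ≤ (V2Closure.SP.par s t).rLab p ∧ 2 ≤ (V2Closure.SP.par s t).bLab p)).card := by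
  -- the theorems for the factors: `D(2,0)`, `D(3,0)`, `D(4,0)` (axis) and `D(3,1)`
  have a2s := tail_axis_unimodal s 1
  have a2t := tail_axis_unimodal t 1
  have a3s := tail_axis_unimodal s 2
  have a3t := tail_axis_unimodal t 2
  have a4s := tail_axis_unimodal s 3
  have a4t := tail_axis_unimodal t 3
  have b31s := t31_le_t22 s
  have b31t := t31_le_t22 t
  rw [tail_b0] at a2s a2t a3s a3t a4s a4t
  -- everything in the cells (`K = 4`)
  rw [tail_cellsK s 4 4 1 (by norm_num) (by norm_num), tail_cellsK s 4 3 2 (by norm_num) (by norm_num)] at hs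
  rw [tail_cellsK t 4 4 1 (by norm_num) (by norm_num), tail_cellsK t 4 3 2 (by norm_num) (by norm_num)] at ht
  rw [tail_cellsK s 4 2 0 (by norm_num) (by norm_num), tail_cellsK s 4 1 1 (by norm_num) (by norm_num)] at a2s
  rw [tail_cellsK t 4 2 0 (by norm_num) (by norm_num), tail_cellsK t 4 1 1 (by norm_num) (by norm_num)] at a2t
  rw [tail_cellsK s 4 3 0 (by norm_num) (by norm_num), tail_cellsK s 4 2 1 (by norm_num) (by norm_num)] at a3s
  rw [tail_cellsK t 4 3 0 (by norm_num) (by norm_num), tail_cellsK t 4 2 1 (by norm_num) (by norm_num)] at a3t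
  rw [tail_cellsK s 4 4 0 (by norm_num) (by norm_num), tail_cellsK s 4 3 1 (by norm_num) (by norm_num)] at a4s
  rw [tail_cellsK t 4 4 0 (by norm_num) (by norm_num), tail_cellsK t 4 3 1 (by norm_num) (by norm_num)] at a4t
  rw [tail_cellsK s 4 3 1 (by norm_num) (by norm_num), tail_cellsK s 4 2 2 (by norm_num) (by norm_num)] at b31s
  rw [tail_cellsK t 4 3 1 (by norm_num) (by norm_num), tail_cellsK t 4 2 2 (by norm_num) (by norm_num)] at b31t
  rw [tail_par_rows s t 4 4 1 (by norm_num) (by norm_num), tail_par_rows s t 4 3 2 (by norm_num) (by norm_num)]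
  simp only [Finset.sum_range_succ, Finset.sum_range_zero]
  rw [tail_cellsK t 4 4 1 (by norm_num) (by norm_num), tail_cellsK t 4 4 0 (by norm_num) (by norm_num),
    tail_cellsK t 4 3 2 (by norm_num) (by norm_num), tail_cellsK t 4 3 1 (by norm_num) (by norm_num),
    tail_cellsK t 4 3 0 (by norm_num) (by norm_num), tail_cellsK t 4 2 2 (by norm_num) (by norm_num),
    tail_cellsK t 4 2 1 (by norm_num) (by norm_num), tail_cellsK t 4 2 0 (by norm_num) (by norm_num),
    tail_cellsK t 4 1 2 (by norm_num) (by norm_num), tail_cellsK t 4 1 1 (by norm_num) (by norm_num),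
    tail_cellsK t 4 1 0 (by norm_num) (by norm_num), tail_cellsK t 4 0 2 (by norm_num) (by norm_num),
    tail_cellsK t 4 0 1 (by norm_num) (by norm_num), tail_cellsK t 4 0 0 (by norm_num) (by norm_num)]
  simp only [Finset.sum_range_succ, Finset.sum_range_zero] at hs ht a2s a2t a3s a3t a4s a4t b31s b31t ⊢
  norm_num at hs ht a2s a2t a3s a3t a4s a4t b31s b31t ⊢
  -- mirror cells
  rw [cellCount_symm s 4 1 0, cellCount_symm s 4 2 0, cellCount_symm s 4 2 1, cellCount_symm s 4 3 0,
    cellCount_symm s 4 3 1, cellCount_symm s 4 3 2, cellCount_symm s 4 4 0, cellCount_symm s 4 4 1,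
    cellCount_symm s 4 4 2, cellCount_symm s 4 4 3, cellCount_symm t 4 1 0, cellCount_symm t 4 2 0,
    cellCount_symm t 4 2 1, cellCount_symm t 4 3 0, cellCount_symm t 4 3 1, cellCount_symm t 4 3 2,
    cellCount_symm t 4 4 0, cellCount_symm t 4 4 1, cellCount_symm t 4 4 2, cellCount_symm t 4 4 3] at *
  -- the certificate
  zify at hs ht a2s a2t a3s a3t a4s a4t b31s b31t ⊢
  have h1 := mul_nonneg (sub_nonneg.2 a3s)
    (by positivity : (0 : ℤ) ≤ cellCount t 4 1 1 + cellCount t 4 1 2 + cellCount t 4 1 3 + cellCount t 4 1 4)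
  have h2 := mul_nonneg (sub_nonneg.2 a4s)
    (by positivity : (0 : ℤ) ≤ cellCount t 4 0 1 + cellCount t 4 0 2 + cellCount t 4 0 3 + cellCount t 4 0 4)
  have h3 := mul_nonneg (sub_nonneg.2 b31s) (by positivity : (0 : ℤ) ≤ cellCount t 4 0 1)
  have h4 := mul_nonneg (sub_nonneg.2 hs) (by positivity : (0 : ℤ) ≤ cellCount t 4 0 0)
  have h5 := mul_nonneg (by positivity : (0 : ℤ) ≤ cellCount s 4 0 0) (sub_nonneg.2 ht)
  have h6 := mul_nonneg (by positivity : (0 : ℤ) ≤ cellCount s 4 0 1) (add_nonneg (sub_nonneg.2 a4t) (sub_nonneg.2 b31t))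
  have h7 := mul_nonneg (by positivity : (0 : ℤ) ≤ cellCount s 4 0 2 + cellCount s 4 0 3 + cellCount s 4 0 4)
    (add_nonneg (sub_nonneg.2 a3t) (sub_nonneg.2 a4t))
  have h8 := mul_nonneg (sub_nonneg.2 a2s) (sub_nonneg.2 a3t)
  have h9 := mul_nonneg (by positivity : (0 : ℤ) ≤ cellCount s 4 0 2 + cellCount s 4 0 3 + cellCount s 4 0 4)
    (by positivity : (0 : ℤ) ≤ cellCount t 4 0 3 + cellCount t 4 0 4)
  have h10 := mul_nonneg (by positivity : (0 : ℤ) ≤ cellCount s 4 0 3 + cellCount s 4 0 4)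
    (by positivity : (0 : ℤ) ≤ cellCount t 4 0 2 + cellCount t 4 0 3 + cellCount t 4 0 4)
  linarith [h1, h2, h3, h4, h5, h6, h7, h8, h9, h10]

/-- **four disjoint red paths with a blue path are rarer than three disjoint red paths with two
disjoint blue paths**, on every pattern of the grammar: `T(4,1) ≤ T(3,2)` -/
theorem t41_le_t32 : ∀ s : V2Closure.SP,
    (Finset.univ.filter (fun y : s.Conf => 4 ≤ s.rLab y ∧ 1 ≤ s.bLab y)).card
      ≤ (Finset.univ.filter (fun y : s.Conf => 3 ≤ s.rLab y ∧ 2 ≤ s.bLab y)).card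
  | .free => by decide
  | .pin => by decide
  | .absent => by decide
  | .ser s t => by
    rw [card_tail_ser, card_tail_ser]
    exact Nat.mul_le_mul (t41_le_t32 s) (t41_le_t32 t)
  | .par s t => t41_le_t32_par s t (t41_le_t32 s) (t41_le_t32 t)

/-- the same in the vocabulary of `Tail2DP2Series` -/
theorem stat_t41_le_t32 (s : V2Closure.SP) :
    stat s (fun r b => 4 ≤ r ∧ 1 ≤ b) ≤ stat s (fun r b => 3 ≤ r ∧ 2 ≤ b) :=
  t41_le_t32 s

end Summit.Ventures.PercRepro2.Tail2D
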